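import Summits.QuantumFields.BalabanUV.Beta.SecondOrderBorderCocycle

/-!
# `BalabanUV.Beta.WardBorderReflection` — binder row D1, (L4): **THE hW BORDER WARD OPERATOR UNDER THE BORDER REFLECTIONS** — it is
# `actB`-EQUIVARIANT; hence the NECESSARY CONSISTENCY IDENTITIES between the hR contact and the hW datum for ANY joint hR∕hW border table,
# and their sufficiency given a Ward model (answer to the row-D1 owner's question Q-an2-g20-1, abstract part)

HONEST FRAMING (cell charter, verbatim): «discharging BetaPertH makes Balaban's UV stability UNCONDITIONAL — a real
constructive-QFT result; it is NOT the continuum limit and NOT the Clay problem.»  Neutral [folklore] algebra over FREE symbols (a bi-table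
`T`, a contact `B`, a right-hand side `F`, scalars `s c`): the only tree facts used are an5's reflection bookkeeping (`sref`, `bref`, `refK`,
`sref_block`, `sum_box_bflip`) and the row-D1 owner an2-g20's `actB` ∕ `stepB` ∕ `stepB_solves_self` ∕ `stepB_solves_other` (K-L1a∕K-L2a) BY NAME.
No statement of Bałaban's papers, no `[cite:]`, no `def`, no `Prop` fact; instantiates NO binder of the β-function wall (0/4: hW, hR, D1Tel, D1Rep);
NOT hW, NOT hR, NOT D1, NOT `BetaPertH`, NOT continuum, NOT Clay.
HONEST DEPENDENCY: continuum YM on T⁴ ⇐ BetaPertH ∧ nine spine estimates (0/9 proved); BetaPertH ⇐ (D1) ∧ (D4) ∧ CAP+tail;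
G-an2-4 gates asym, D1 and NE2/3/4.

THE QUESTION (an2-g20, journal 2026-08-20 «Q-an2-g20-1»): the hR border socket is `actB_α T − T = B_α` (all four axes), solved by the owner's
`Twall` (K-L2b) and, by `solution_iff`, by exactly `Twall +` (border-`actB`-invariant tables); the hW border socket (leaf-06's END p219370 ∕ p220335,
hBord0) is `W_Y(T)(κ′,u′) = F_Y(κ′,u′)` with the LINEAR block Ward operator
`W_Y(T)(κ′,u′) := s • Σ_{v ∈ box} divV (κ u ↦ c • T κ u κ′ u′) (Lc•Y + v)` — «is the hW socket of the form "linear operator commuting with `actB`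
= first-order data"?».  ANSWER HERE (generic `d`, any `N`, `Lc`, `s`, `c`):
* §1 `divV_actB`, **`wardOp_actB`**: `W` is `actB`-EQUIVARIANT — `W_Y(actB_α T)(κ′,u′) = ε_α(κ′) • refK_α (W_{sref α Y}(T)(κ′, bref α κ′ u′))`
  (the block `Y` reflects onto the block `sref α Y`; for the `α`-bonds `bref α α (y − e_α) = sref α y`, `bref α α y = sref α y − e_α` and the sign
  `ε_α(α) = −1` swaps the two divergence terms back).
* §2 **`joint_consistency_necessary`**: if ONE table solves `actB_α T − T = B` and `∀ Y κ′ u′, W_Y(T)(κ′,u′) = F Y κ′ u′`, then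
  `∀ Y κ′ u′, W_Y(B)(κ′,u′) = ε_α(κ′) • refK_α (F (sref α Y) κ′ (bref α κ′ u′)) − F Y κ′ u′` — the hW datum is NOT `actB`-invariant in general, and
  its reflection defect must EQUAL the Ward divergence of the hR contact: a necessary condition on the PAIR of typed sockets, first-order data only.
* §3 **`ward_stepB`**: conversely, under that identity the owner's step `stepB_α B` maps `W`-solutions to `W`-solutions; **`ward_steps_two`**:
  two axes with the cocycle identity and the two consistency identities — from ANY Ward solution the two steps give a table solving BOTH reflection
  letters AND the Ward letter (`stepB_solves_self∕other` BY NAME); the four-axis version is the same bookkeeping (K-L2b's `Twall_solves` pattern).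
NOT HERE (part 2): the wall identity itself, `W_Y(bdB (wallD₀ α)) = G_α` for `F := conjV (c′ • vhSAt ρ_c κ′ u′) D_Y` of p219370 — the decisive
entrywise computation; this file fixes its exact statement.
Provenance: β sub-cell, D1 formalisation swarm, unit b2b-balaban-beta-d1-formalise-leaf-04 gen 4, 2026-08-20 (v1); no existing file touched.
-/

open Finset
open scoped BigOperators
open Literature.MathematicalPhysics.QuantumFieldTheory
open Literature.MathematicalPhysics.QuantumFieldTheory.Balaban1983to89
open Literature.MathematicalPhysics.QuantumFieldTheory.Balaban1983to89.Beta
open ExpKernelCalculus (MKer)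
open AffineAveraging (box toSite)
open KernelWard (divV)
open PolarizationSign (reflSign)
open KernelReflection (LegMap refK refK_apply)
open ResolventReflection (sref sref_apply sref_sub bref bref_apply bref_self bref_of_ne Φ Φ_r_inl Φ_r_inr Φ_s_inl Φ_s_inr reflSign_self
  reflSign_of_ne reflSign_mul_self axisReflect_unitVec_of_ne axisReflect_unitVec_self bflip sum_box_bflip sref_block)
open OneStepResolventKernel (Fib)
open Summit.QuantumFields.BalabanUV.Beta.TameKernelCalculus
open Summit.QuantumFields.BalabanUV.Beta.E3LevelOneReflection (refK_add refK_smul refK_sub)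
open Summit.QuantumFields.BalabanUV.Beta.SecondOrderBorderGauge (actB actB_apply actB_add actB_sub actB_smul)
open Summit.QuantumFields.BalabanUV.Beta.SecondOrderBorderCocycle (stepB stepB_solves_self stepB_solves_other actB_comm)

namespace Summit.QuantumFields.BalabanUV.Beta.WardBorderReflection

noncomputable section

variable {d : ℕ}

/-! ## §1 The block Ward operator is `actB`-equivariant -/

section Equivariance

variable (N : ℕ) (α : Fin (d + 1))

/-- [folklore] The two spellings of the unit vector agree (`KernelWard.divV` uses `B6BondElimination.unitVec`, the reflections use
`AffineAveraging.unitVec`). -/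
theorem unitVec_eq (κ : Fin (d + 1)) : (B6BondElimination.unitVec κ : Fin (d + 1) → ℤ) = AffineAveraging.unitVec κ := by
  funext i; simp [B6BondElimination.unitVec_apply, AffineAveraging.unitVec_apply]

/-- [folklore] For a bond of direction `κ ≠ α`: `bref α κ (y − e_κ) = sref α y − e_κ`. -/
theorem bref_sub_unitVec_of_ne {κ : Fin (d + 1)} (h : κ ≠ α) (y : Fin (d + 1) → ℤ) :
    bref α κ (y - B6BondElimination.unitVec κ) = sref α y - B6BondElimination.unitVec κ := by
  rw [unitVec_eq, bref_of_ne h, sref_sub, axisReflect_unitVec_of_ne h]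

/-- [folklore] For the reflected axis itself: `bref α α (y − e_α) = sref α y` (the reflected backward bond is re-based one step up). -/
theorem bref_self_sub_unitVec (y : Fin (d + 1) → ℤ) : bref α α (y - B6BondElimination.unitVec α) = sref α y := by
  rw [unitVec_eq, bref_self, sref_sub, axisReflect_unitVec_self, sub_neg_eq_add, add_sub_cancel_right]

/-- [folklore] `bref α α y = sref α y − e_α` in the `divV` spelling of the unit vector. -/
theorem bref_self_eq (y : Fin (d + 1) → ℤ) : bref α α y = sref α y - B6BondElimination.unitVec α := by
  rw [unitVec_eq, bref_self]

/-- [folklore] **THE FIRST-SLOT DIVERGENCE OF A REFLECTED BI-TABLE** (every site, exactly):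
`divV (κ u ↦ actB N α T κ u κ′ u′) y = ε_α(κ′) • refK_α (divV (κ u ↦ T κ u κ′ (bref α κ′ u′)) (sref α y))`. -/
theorem divV_actB (T : Fin (d + 1) → (Fin (d + 1) → ℤ) → Fin (d + 1) → (Fin (d + 1) → ℤ) → MKer (d + 1) (Fib d))
    (κ' : Fin (d + 1)) (u' y : Fin (d + 1) → ℤ) :
    divV (fun κ u => actB N α T κ u κ' u') y =
      reflSign α κ' • refK (Φ (d := d) N α) (divV (fun κ u => T κ u κ' (bref α κ' u')) (sref α y)) := by
  funext x z a b
  simp only [KernelWard.divV, Finset.sum_apply, Pi.sub_apply, Pi.smul_apply, smul_eq_mul, refK_apply, actB_apply]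
  rw [Finset.mul_sum, Finset.mul_sum]
  refine Finset.sum_congr rfl fun κ _ => ?_
  by_cases hκ : κ = α
  · subst hκ
    rw [reflSign_self, bref_self_sub_unitVec, bref_self_eq]
    ring
  · rw [reflSign_of_ne hκ, bref_sub_unitVec_of_ne α hκ, bref_of_ne hκ]
    ring

/-- [folklore] `refK` is additive over finite sums. -/
theorem sum_refK {ι : Type*} (S : Finset ι) (Ψ : LegMap (d + 1) (Fib d)) (K : ι → MKer (d + 1) (Fib d)) :
    ∑ i ∈ S, refK Ψ (K i) = refK Ψ (∑ i ∈ S, K i) := by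
  classical
  induction S using Finset.induction_on with
  | empty => funext x z a b; simp [refK_apply]
  | insert i S hi ih => rw [Finset.sum_insert hi, Finset.sum_insert hi, ih, refK_add]

/-- [folklore] `divV` is additive in the stencil family. -/
theorem divV_add' (V V' : Fin (d + 1) → (Fin (d + 1) → ℤ) → MKer (d + 1) (Fib d)) (y : Fin (d + 1) → ℤ) :
    divV (fun κ u => V κ u + V' κ u) y = divV V y + divV V' y := by
  simp only [KernelWard.divV, ← Finset.sum_add_distrib]
  refine Finset.sum_congr rfl fun κ _ => ?_
  abel

/-- [folklore] `divV` is homogeneous in the stencil family. -/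
theorem divV_smul' (a : ℝ) (V : Fin (d + 1) → (Fin (d + 1) → ℤ) → MKer (d + 1) (Fib d)) (y : Fin (d + 1) → ℤ) :
    divV (fun κ u => a • V κ u) y = a • divV V y := by
  simp only [KernelWard.divV, Finset.smul_sum, smul_sub]

/-- [folklore] `divV` of a difference of stencil families. -/
theorem divV_sub' (V V' : Fin (d + 1) → (Fin (d + 1) → ℤ) → MKer (d + 1) (Fib d)) (y : Fin (d + 1) → ℤ) :
    divV (fun κ u => V κ u - V' κ u) y = divV V y - divV V' y := by
  simp only [KernelWard.divV, ← Finset.sum_sub_distrib]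
  refine Finset.sum_congr rfl fun κ _ => ?_
  abel

/-- [folklore] **THE BLOCK WARD OPERATOR IS `actB`-EQUIVARIANT**: for any scalars `s c`, any block index `Y` and second bond `(κ′, u′)`,
`s • Σ_{v∈box} divV (κ u ↦ c • actB_α T κ u κ′ u′) (Lc•Y + v) = ε_α(κ′) • refK_α (s • Σ_{v∈box} divV (κ u ↦ c • T κ u κ′ (bref α κ′ u′)) (Lc • sref α Y + v))`
— the block `Y` reflects onto the block `sref α Y` (`sref_block` + `sum_box_bflip`). -/
theorem wardOp_actB (Lc : ℕ) (s c : ℝ) (T : Fin (d + 1) → (Fin (d + 1) → ℤ) → Fin (d + 1) → (Fin (d + 1) → ℤ) → MKer (d + 1) (Fib d))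
    (Y : Fin (d + 1) → ℤ) (κ' : Fin (d + 1)) (u' : Fin (d + 1) → ℤ) :
    s • ∑ v ∈ box (d + 1) Lc, divV (fun κ u => c • actB N α T κ u κ' u') ((Lc : ℤ) • Y + toSite v) =
      reflSign α κ' • refK (Φ (d := d) N α)
        (s • ∑ v ∈ box (d + 1) Lc, divV (fun κ u => c • T κ u κ' (bref α κ' u')) ((Lc : ℤ) • sref α Y + toSite v)) := by
  -- `c • actB T = actB (c • T)` pointwise in the bond indices
  have hc : (fun κ u => c • actB N α T κ u κ' u') = fun κ u => actB N α (c • T) κ u κ' u' := by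
    funext κ u
    rw [show (c • T) = c • T from rfl, actB_smul]; rfl
  rw [hc]
  have h1 : ∀ v ∈ box (d + 1) Lc, divV (fun κ u => actB N α (c • T) κ u κ' u') ((Lc : ℤ) • Y + toSite v) =
      reflSign α κ' • refK (Φ (d := d) N α)
        (divV (fun κ u => (c • T) κ u κ' (bref α κ' u')) ((Lc : ℤ) • sref α Y + toSite (bflip α Lc v))) := by
    intro v hv
    rw [divV_actB, sref_block α hv]
  rw [Finset.sum_congr rfl h1, ← Finset.smul_sum]
  -- pull `refK` (additive) out of the sum and re-index the box
  have h2 : ∑ v ∈ box (d + 1) Lc, refK (Φ (d := d) N α)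
        (divV (fun κ u => (c • T) κ u κ' (bref α κ' u')) ((Lc : ℤ) • sref α Y + toSite (bflip α Lc v))) =
      refK (Φ (d := d) N α) (∑ v ∈ box (d + 1) Lc, divV (fun κ u => c • T κ u κ' (bref α κ' u')) ((Lc : ℤ) • sref α Y + toSite v)) := by
    rw [sum_box_bflip α Lc (fun v => refK (Φ (d := d) N α)
      (divV (fun κ u => (c • T) κ u κ' (bref α κ' u')) ((Lc : ℤ) • sref α Y + toSite v)))]
    rw [sum_refK]
    rfl
  rw [h2, refK_smul, smul_comm]

end Equivariance

/-! ## §2 The necessary consistency identities for a joint reflection ∕ Ward border table -/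

section Necessary

variable {N Lc : ℕ} {α : Fin (d + 1)} {s c : ℝ}
  {T B : Fin (d + 1) → (Fin (d + 1) → ℤ) → Fin (d + 1) → (Fin (d + 1) → ℤ) → MKer (d + 1) (Fib d)}
  {F : (Fin (d + 1) → ℤ) → Fin (d + 1) → (Fin (d + 1) → ℤ) → MKer (d + 1) (Fib d)}

/-- [folklore] **JOINT SOLUTION ⟹ CONSISTENCY**: if one table `T` solves the reflection letter of axis `α`, `actB_α T − T = B`, AND the Ward letter
`∀ Y κ′ u′, s • Σ_v divV (κ u ↦ c • T κ u κ′ u′) (Lc•Y + v) = F Y κ′ u′`, then the Ward divergence of the contact equals the reflection defect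
of the datum: `∀ Y κ′ u′, s • Σ_v divV (κ u ↦ c • B κ u κ′ u′) (Lc•Y + v) = ε_α(κ′) • refK_α (F (sref α Y) κ′ (bref α κ′ u′)) − F Y κ′ u′`. -/
theorem joint_consistency_necessary (hR : actB N α T - T = B)
    (hW : ∀ (Y : Fin (d + 1) → ℤ) (κ' : Fin (d + 1)) (u' : Fin (d + 1) → ℤ),
      s • ∑ v ∈ box (d + 1) Lc, divV (fun κ u => c • T κ u κ' u') ((Lc : ℤ) • Y + toSite v) = F Y κ' u')
    (Y : Fin (d + 1) → ℤ) (κ' : Fin (d + 1)) (u' : Fin (d + 1) → ℤ) :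
    s • ∑ v ∈ box (d + 1) Lc, divV (fun κ u => c • B κ u κ' u') ((Lc : ℤ) • Y + toSite v) =
      reflSign α κ' • refK (Φ (d := d) N α) (F (sref α Y) κ' (bref α κ' u')) - F Y κ' u' := by
  rw [← hR, ← hW (sref α Y) κ' (bref α κ' u'), ← wardOp_actB N α Lc s c T Y κ' u', ← hW Y κ' u']
  -- linearity of the Ward operator in the table
  rw [← smul_sub, ← Finset.sum_sub_distrib]
  congr 1
  refine Finset.sum_congr rfl fun v _ => ?_
  rw [← divV_sub']
  congr 1
  funext κ u
  simp only [Pi.sub_apply, smul_sub]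

end Necessary

/-! ## §3 Sufficiency: the owner's step preserves Ward solutions under the consistency identity -/

section Sufficient

variable {N Lc : ℕ} {α β : Fin (d + 1)} {s c : ℝ}
  {B Bα Bβ T : Fin (d + 1) → (Fin (d + 1) → ℤ) → Fin (d + 1) → (Fin (d + 1) → ℤ) → MKer (d + 1) (Fib d)}
  {F : (Fin (d + 1) → ℤ) → Fin (d + 1) → (Fin (d + 1) → ℤ) → MKer (d + 1) (Fib d)}

/-- [folklore] The block Ward operator is linear in the table: value on `x • T₁ + y • T₂`. -/
theorem wardOp_linear (Lc : ℕ) (s c x y : ℝ) (T₁ T₂ : Fin (d + 1) → (Fin (d + 1) → ℤ) → Fin (d + 1) → (Fin (d + 1) → ℤ) → MKer (d + 1) (Fib d))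
    (Y : Fin (d + 1) → ℤ) (κ' : Fin (d + 1)) (u' : Fin (d + 1) → ℤ) :
    s • ∑ v ∈ box (d + 1) Lc, divV (fun κ u => c • (x • T₁ + y • T₂) κ u κ' u') ((Lc : ℤ) • Y + toSite v) =
      x • (s • ∑ v ∈ box (d + 1) Lc, divV (fun κ u => c • T₁ κ u κ' u') ((Lc : ℤ) • Y + toSite v)) +
      y • (s • ∑ v ∈ box (d + 1) Lc, divV (fun κ u => c • T₂ κ u κ' u') ((Lc : ℤ) • Y + toSite v)) := by
  have e : (fun κ u => c • (x • T₁ + y • T₂) κ u κ' u') =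
      fun κ u => (x • (c • T₁ κ u κ' u') + y • (c • T₂ κ u κ' u')) := by
    funext κ u
    simp only [Pi.add_apply, Pi.smul_apply, smul_add, smul_comm c x, smul_comm c y]
  rw [e]
  have e2 : ∀ v ∈ box (d + 1) Lc, divV (fun κ u => (x • (c • T₁ κ u κ' u') + y • (c • T₂ κ u κ' u'))) ((Lc : ℤ) • Y + toSite v) =
      x • divV (fun κ u => c • T₁ κ u κ' u') ((Lc : ℤ) • Y + toSite v) + y • divV (fun κ u => c • T₂ κ u κ' u') ((Lc : ℤ) • Y + toSite v) := by
    intro v _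
    have h := divV_add' (fun κ u => x • (c • T₁ κ u κ' u')) (fun κ u => y • (c • T₂ κ u κ' u')) ((Lc : ℤ) • Y + toSite v)
    rw [h, divV_smul' x (fun κ u => c • T₁ κ u κ' u'), divV_smul' y (fun κ u => c • T₂ κ u κ' u')]
  rw [Finset.sum_congr rfl e2, Finset.sum_add_distrib, ← Finset.smul_sum, ← Finset.smul_sum, smul_add, smul_comm s x, smul_comm s y]

/-- [folklore] **THE STEP PRESERVES WARD SOLUTIONS UNDER THE CONSISTENCY IDENTITY**: if `T` solves the Ward letter with datum `F` and the Ward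
divergence of the contact `B` equals the reflection defect of `F`, then the owner's `stepB N α B T = ½•(T + actB_α T) − ½•B` solves the Ward letter. -/
theorem ward_stepB
    (hW : ∀ (Y : Fin (d + 1) → ℤ) (κ' : Fin (d + 1)) (u' : Fin (d + 1) → ℤ),
      s • ∑ v ∈ box (d + 1) Lc, divV (fun κ u => c • T κ u κ' u') ((Lc : ℤ) • Y + toSite v) = F Y κ' u')
    (hC : ∀ (Y : Fin (d + 1) → ℤ) (κ' : Fin (d + 1)) (u' : Fin (d + 1) → ℤ),
      s • ∑ v ∈ box (d + 1) Lc, divV (fun κ u => c • B κ u κ' u') ((Lc : ℤ) • Y + toSite v) =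
        reflSign α κ' • refK (Φ (d := d) N α) (F (sref α Y) κ' (bref α κ' u')) - F Y κ' u')
    (Y : Fin (d + 1) → ℤ) (κ' : Fin (d + 1)) (u' : Fin (d + 1) → ℤ) :
    s • ∑ v ∈ box (d + 1) Lc, divV (fun κ u => c • stepB N α B T κ u κ' u') ((Lc : ℤ) • Y + toSite v) = F Y κ' u' := by
  have e : stepB N α B T = (1 / 2 : ℝ) • (T + actB N α T) + (-(1 / 2 : ℝ)) • B := by
    unfold SecondOrderBorderCocycle.stepB; rw [neg_smul, sub_eq_add_neg]
  have e' : T + actB N α T = (1 : ℝ) • T + (1 : ℝ) • actB N α T := by rw [one_smul, one_smul]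
  rw [e, wardOp_linear, e', wardOp_linear, wardOp_actB N α Lc s c T Y κ' u', hW, hW, hC]
  module

/-- [folklore] **TWO AXES FROM ANY WARD SOLUTION** (the pattern of K-L2b's `Twall_solves`, started at a Ward solution instead of `0`): with anti-invariant
contacts, the cocycle identity and BOTH consistency identities, the two sequential steps give a table solving the two reflection letters AND the Ward letter —
so a JOINT model exists as soon as the Ward socket alone has one (and the consistency identities, necessary by `joint_consistency_necessary`, hold). -/
theorem ward_steps_two (hα : actB N α Bα = -Bα) (hβ : actB N β Bβ = -Bβ) (hc : Bβ + actB N β Bα = Bα + actB N α Bβ)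
    (hW : ∀ (Y : Fin (d + 1) → ℤ) (κ' : Fin (d + 1)) (u' : Fin (d + 1) → ℤ),
      s • ∑ v ∈ box (d + 1) Lc, divV (fun κ u => c • T κ u κ' u') ((Lc : ℤ) • Y + toSite v) = F Y κ' u')
    (hCα : ∀ (Y : Fin (d + 1) → ℤ) (κ' : Fin (d + 1)) (u' : Fin (d + 1) → ℤ),
      s • ∑ v ∈ box (d + 1) Lc, divV (fun κ u => c • Bα κ u κ' u') ((Lc : ℤ) • Y + toSite v) =
        reflSign α κ' • refK (Φ (d := d) N α) (F (sref α Y) κ' (bref α κ' u')) - F Y κ' u')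
    (hCβ : ∀ (Y : Fin (d + 1) → ℤ) (κ' : Fin (d + 1)) (u' : Fin (d + 1) → ℤ),
      s • ∑ v ∈ box (d + 1) Lc, divV (fun κ u => c • Bβ κ u κ' u') ((Lc : ℤ) • Y + toSite v) =
        reflSign β κ' • refK (Φ (d := d) N β) (F (sref β Y) κ' (bref β κ' u')) - F Y κ' u') :
    let T₂ := stepB N β Bβ (stepB N α Bα T)
    (actB N α T₂ - T₂ = Bα) ∧ (actB N β T₂ - T₂ = Bβ) ∧
      (∀ (Y : Fin (d + 1) → ℤ) (κ' : Fin (d + 1)) (u' : Fin (d + 1) → ℤ),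
        s • ∑ v ∈ box (d + 1) Lc, divV (fun κ u => c • T₂ κ u κ' u') ((Lc : ℤ) • Y + toSite v) = F Y κ' u') := by
  refine ⟨?_, stepB_solves_self hβ _, ?_⟩
  · exact stepB_solves_other (stepB_solves_self hα T) hc
  · intro Y κ' u'
    exact ward_stepB (fun Y κ' u' => ward_stepB hW hCα Y κ' u') hCβ Y κ' u'

end Sufficient

end

end Summit.QuantumFields.BalabanUV.Beta.WardBorderReflection
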